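import Literature.Geometry.Lorentzian.MaxAtlasChartKilling
import Literature.Geometry.Lorentzian.AnalyticChartMetric
import Literature.Geometry.Lorentzian.NomizuKillingExtension
import Literature.Geometry.Lorentzian.KillingOpensJetRigidity
import Literature.Geometry.Lorentzian.KillingAlgebraAsymptoticallyFlatProofs
import Literature.Geometry.Lorentzian.LeviCivitaLocality
import Literature.Geometry.Lorentzian.MetricValCongr
import HarnessLib

/-!
# Nomizu's extension of Killing fields, read in a chart with analytic metric components

Nomizu's theorem (pseudo-Riemannian form: Chruściel 1997, Thm. 2.1; the tree's named fact
`PseudoRiemannianMetric.Nomizu1960_killing_extension`, `NomizuKillingExtension.lean`) extends a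
Killing field given on a connected open subset of a SIMPLY CONNECTED REAL-ANALYTIC
pseudo-Riemannian manifold to the whole manifold. The spacetimes of the tree are `C^∞` manifolds
with `C^∞` metrics; real-analyticity is available only CHARTWISE (the metric components are
analytic in suitable coordinates — e.g. the conclusion of Müller zum Hagen's theorem,
`ChartwiseAnalyticity.lean`). This file performs the bookkeeping that applies Nomizu's theorem
LOCALLY, on the domain of such a chart:

* `MaxAtlasChart.analyticOnNhd_metricRepr_apply₂` — if the components
  `p ↦ g(dψ⁻¹_p a, dψ⁻¹_p b)` are analytic on `ψ.target`, so are the components of the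
  transported metric `Ψ^* g` (`MaxAtlasChart.metric`) on the open submanifold `ψ.target ⊆ E`;
  hence (`AnalyticChartMetric.lean`) `Ψ^* g` has the values of a `C^ω` metric on `ψ.target`, with
  the same Levi-Civita connection (`MetricValCongr.lean`).
* `MaxAtlasChart.exists_killingOn_source_eqOn` — **local Nomizu**: assuming the named fact, for
  `ψ ∈ maximalAtlas` with analytic metric components and simply connected target, and a Killing
  field `L` of `g` on an open `D` such that `ψ '' (ψ.source ∩ D)` is connected (non-empty), there
  is a Killing field `L'` of `g` on `ψ.source` with `L' = L` on `ψ.source ∩ D` (down along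
  `Ψ = ψ⁻¹`, Nomizu on the chart target, up again: `MaxAtlasChartKilling.lean`).
* `MaxAtlasChart.mlieBracket_eqOn_source_zero` — **commutation propagates** (no analyticity, no
  named fact): if moreover `T` is a global Killing field with `[T, L] = 0` on `D`, then every
  Killing field `L'` of `g` on `ψ.source` agreeing with `L` on `ψ.source ∩ D` has `[T, L'] = 0` on
  `ψ.source`, provided `ψ.target` is preconnected: on the chart target `[Ψ^*T, Ψ^*L']` is a global
  Killing field (O'Neill 1983, Ch. 9, Lemma 9.28 ff.: brackets of Killing fields are Killing, the
  tree's `IsKillingField.mlieBracket_vectorField`) vanishing on the non-empty open `Ψ ⁻¹' D`, hence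
  identically by one-jet rigidity (`OpensChart.IsKillingField.eq_zero_of_oneJet_eq_zero'`).
* `MaxAtlasChart.exists_killingOn_source_mlieBracket_zero_eqOn` — the two combined.

Everything is proved modulo the explicit hypothesis `Nomizu1960_killing_extension` (whose model
space and manifold live in `Type`, whence `E : Type` below); no definitions, no new named facts.

## References

* K. Nomizu, *On local and global existence of Killing vector fields*, Ann. of Math. 72 (1960)
  105–120, Thms. 1–2. [Nomizu1960]
* P. T. Chruściel, *On rigidity of analytic black holes*, Comm. Math. Phys. 189 (1997) 1–7,
  Thm. 2.1. [Chrusciel1997]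
* B. O'Neill, *Semi-Riemannian geometry with applications to relativity*, Academic Press 1983,
  Ch. 9, Prop. 9.25, Lemma 9.28. [ONeill1983]
-/

noncomputable section

open Bundle Set Function Filter TopologicalSpace Manifold VectorField
open scoped Manifold ContDiff Topology

namespace Literature.Geometry.Lorentzian

namespace MaxAtlasChart

variable {E : Type*} [NormedAddCommGroup E] [NormedSpace ℝ E] [FiniteDimensional ℝ E]
  {X : Type*} [TopologicalSpace X] [ChartedSpace E X] [IsManifold 𝓘(ℝ, E) ∞ X]
  {ψ : OpenPartialHomeomorph X E}
  (g : PseudoRiemannianMetric 𝓘(ℝ, E) ∞ E (TangentSpace 𝓘(ℝ, E) : X → Type _))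

/-! ### Analytic metric components in the chart -/

/-- **Analytic chart components give an analytic representative of the transported metric.** If
every component `p ↦ g_{ψ⁻¹ p}(dψ⁻¹_p a, dψ⁻¹_p b)` is real-analytic on `ψ.target`, then so is
every component of the representative `metricRepr` of `Ψ^* g` (they agree on the open target,
`metric_val`, `mfderiv_inv`). [folklore] -/
theorem analyticOnNhd_metricRepr_apply₂ (hψ : ψ ∈ IsManifold.maximalAtlas 𝓘(ℝ, E) ∞ X)
    (hA : ∀ a b : E, AnalyticOnNhd ℝ
      (fun p : E ↦ g.val (ψ.symm p) (mfderiv 𝓘(ℝ, E) 𝓘(ℝ, E) ψ.symm p a)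
        (mfderiv 𝓘(ℝ, E) 𝓘(ℝ, E) ψ.symm p b)) ψ.target) (a b : E) :
    AnalyticOnNhd ℝ (fun p : E ↦ metricRepr g hψ p a b) ψ.target := by
  intro z hz
  refine (hA a b z hz).congr ?_
  filter_upwards [ψ.open_target.mem_nhds hz] with p hp
  have h1 : metricRepr g hψ p a b = g.val (ψ.symm p) (mfderiv 𝓘(ℝ, E) 𝓘(ℝ, E) (inv ψ) ⟨p, hp⟩ a)
      (mfderiv 𝓘(ℝ, E) 𝓘(ℝ, E) (inv ψ) ⟨p, hp⟩ b) := by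
    rw [← metric_val_eq_repr g hψ ⟨p, hp⟩]
    rfl
  rw [h1, mfderiv_inv hψ]
  rfl

/-- **The transported metric has the values of a `C^ω` metric on the chart target** (with the
same Levi-Civita connection), when the chart components of `g` are analytic.
[cite: ONeill1983, Ch. 3, Def. 3.1] -/
theorem exists_analyticMetric_target (hψ : ψ ∈ IsManifold.maximalAtlas 𝓘(ℝ, E) ∞ X)
    (hA : ∀ a b : E, AnalyticOnNhd ℝ
      (fun p : E ↦ g.val (ψ.symm p) (mfderiv 𝓘(ℝ, E) 𝓘(ℝ, E) ψ.symm p a)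
        (mfderiv 𝓘(ℝ, E) 𝓘(ℝ, E) ψ.symm p b)) ψ.target) :
    ∃ g' : PseudoRiemannianMetric 𝓘(ℝ, E) ω E (TangentSpace 𝓘(ℝ, E) : target ψ → Type _),
      ∀ p : target ψ, g'.val p = (metric g hψ).val p :=
  OpensChart.exists_analyticMetric_of_analyticOnNhd_apply₂ (metric g hψ) (metric_val_eq_repr g hψ)
    (analyticOnNhd_metricRepr_apply₂ g hψ hA)

/-! ### Commutation with a global Killing field propagates along the chart domain -/

variable [CompleteSpace E] [g.HasLeviCivita]

/-- **`[T, L'] = 0` propagates from `ψ.source ∩ D` to `ψ.source`.** Let `ψ ∈ maximalAtlas` have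
preconnected target, `T` a global Killing field of `g`, `L'` a Killing field of `g` on `ψ.source`,
and `D` an open set meeting `ψ.source` such that `[T, L'] = 0` on `ψ.source ∩ D`. Then `[T, L'] = 0`
on `ψ.source`: on the chart target, `Z = [Ψ^*T, Ψ^*L']` is a GLOBAL Killing field of `Ψ^* g`
(brackets of Killing fields are Killing, O'Neill 1983, Ch. 9, Lemma 9.28 ff.), it equals
`Ψ^*[T, L'] = 0` on the non-empty open `Ψ ⁻¹' D`, so its one-jet vanishes there and `Z = 0` by
one-jet rigidity (O'Neill 1983, Ch. 9, Lemma 9.28); finally `[T, L'](Ψ p) = dΨ_p (Z p) = 0`.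
[cite: ONeill1983, Ch. 9, Lemma 9.28] -/
theorem mlieBracket_eqOn_source_zero (hψ : ψ ∈ IsManifold.maximalAtlas 𝓘(ℝ, E) ∞ X)
    (hpc : IsPreconnected ψ.target) {T L' : Π x : X, TangentSpace 𝓘(ℝ, E) x}
    (hT : g.IsKillingField T) (hL' : g.IsKillingFieldOn L' ψ.source) {D : Set X} (hD : IsOpen D)
    (hne : (ψ.source ∩ D).Nonempty) (hTL' : ∀ x ∈ ψ.source ∩ D, mlieBracket 𝓘(ℝ, E) T L' x = 0) :
    ∀ x ∈ ψ.source, mlieBracket 𝓘(ℝ, E) T L' x = 0 := by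
  haveI := (metric g hψ).hasLeviCivita
  -- the transported fields are global Killing fields of `Ψ^* g`
  have hTB : (metric g hψ).IsKillingField (mpullback 𝓘(ℝ, E) 𝓘(ℝ, E) (inv ψ) T) :=
    isKillingField_mpullback_inv g hψ hT
  have hYB : (metric g hψ).IsKillingField (mpullback 𝓘(ℝ, E) 𝓘(ℝ, E) (inv ψ) L') := by
    rw [← PseudoRiemannianMetric.isKillingFieldOn_univ]
    have h := isKillingFieldOn_mpullback_inv g hψ ψ.open_source hL'
    have huniv : (inv ψ ⁻¹' ψ.source : Set (target ψ)) = univ :=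
      eq_univ_of_forall fun p ↦ inv_mem_source p
    rwa [huniv] at h
  set Z : Π p : target ψ, TangentSpace 𝓘(ℝ, E) p :=
    mlieBracket 𝓘(ℝ, E) (mpullback 𝓘(ℝ, E) 𝓘(ℝ, E) (inv ψ) T)
      (mpullback 𝓘(ℝ, E) 𝓘(ℝ, E) (inv ψ) L') with hZ
  have hZK : (metric g hψ).IsKillingField Z := hTB.mlieBracket_vectorField hYB
  -- differentiability of `T`, `L'` on the source
  have hTd : ∀ p : target ψ, MDiffAt (T% T) (inv ψ p) := fun p ↦
    (hT.contMDiff _).mdifferentiableAt (by simp)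
  have hL'd : ∀ p : target ψ, MDiffAt (T% L') (inv ψ p) := fun p ↦
    hL'.mdifferentiableAt ψ.open_source (inv_mem_source p)
  -- `Z = Ψ^* [T, L']` vanishes on `Ψ ⁻¹' D`
  have hZO : ∀ p : target ψ, inv ψ p ∈ D → Z p = 0 := by
    intro p hp
    haveI : IsManifold 𝓘(ℝ, E) (minSmoothness ℝ 2) X := by
      rw [minSmoothness_of_isRCLikeNormedField]; infer_instance
    have hn : minSmoothness ℝ 2 ≤ (∞ : ℕ∞ω) := by
      rw [minSmoothness_of_isRCLikeNormedField]; exact ENat.LEInfty.out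
    have h := mpullback_mlieBracket (I := 𝓘(ℝ, E)) (I' := 𝓘(ℝ, E)) (hTd p) (hL'd p)
      ((contMDiff_inv' hψ) p) hn
    rw [hZ, ← h, mpullback_apply, hTL' _ ⟨inv_mem_source p, hp⟩, map_zero]
  -- hence identically, by one-jet rigidity at a point of `Ψ ⁻¹' D`
  obtain ⟨x₀, hx₀s, hx₀D⟩ := hne
  obtain ⟨p₀, rfl⟩ := exists_inv_eq hx₀s
  have hO : IsOpen (inv ψ ⁻¹' D : Set (target ψ)) := isOpen_inv_preimage hD
  have hev : Z =ᶠ[𝓝 p₀] (0 : Π p : target ψ, TangentSpace 𝓘(ℝ, E) p) := by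
    filter_upwards [hO.mem_nhds hx₀D] with p hp
    exact hZO p hp
  have h0 : Z p₀ = 0 := hZO p₀ hx₀D
  have h1 : ∀ v : E, (metric g hψ).leviCivita Z p₀ v = 0 := fun v ↦ by
    rw [PseudoRiemannianMetric.leviCivita_congr_nhds _ hev, (metric g hψ).leviCivita.zero]
    rfl
  have hall := PseudoRiemannianMetric.IsKillingField.eq_zero_of_oneJet_eq_zero'
    (U := target ψ) hpc hZK h0 h1
  -- back on `X`
  intro x hx
  obtain ⟨p, rfl⟩ := exists_inv_eq hx
  rw [mlieBracket_inv_eq hψ p (hTd p) (hL'd p)]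
  show mfderiv 𝓘(ℝ, E) 𝓘(ℝ, E) (inv ψ) p (Z p) = 0
  rw [hall p, map_zero]

/-! ### Local Nomizu: extension across the chart domain -/

/-- **Local Nomizu in a chart with analytic metric components.** Assume Nomizu's extension theorem
(`PseudoRiemannianMetric.Nomizu1960_killing_extension`). Let `g` be a `C^∞` metric on `X`,
`ψ ∈ maximalAtlas` a chart in which all components `p ↦ g(dψ⁻¹_p a, dψ⁻¹_p b)` of `g` are
real-analytic on `ψ.target` and whose target is simply connected, and `L` a Killing field of `g`
on an open `D ⊆ X` such that `ψ '' (ψ.source ∩ D)` is connected (and non-empty). Then there is a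
Killing field `L'` of `g` on `ψ.source` (`C^∞` on `ψ.source`, Killing equation at its points) with
`L' = L` on `ψ.source ∩ D`. Proof: `Ψ^* g` on the open submanifold `ψ.target ⊆ E` (an analytic,
boundaryless, simply connected manifold) has the values of a `C^ω` metric with the same connection
(`exists_analyticMetric_target`); `Ψ^* L` is a Killing field of it on the connected open `Ψ ⁻¹' D`
(`isKillingFieldOn_mpullback_inv`); Nomizu extends it to a global smooth Killing field `Ŷ` of the
target, which is `Ψ^* L'` for a field `L'` smooth on `ψ.source`
(`exists_contMDiffOn_source_mpullback_inv_eq`), Killing there (`killingOn_source_of_mpullback_inv`)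
and equal to `L` on `ψ.source ∩ D`. Nomizu 1960, Thms. 1–2; Chruściel 1997, Thm. 2.1.
[cite: Chrusciel1997, Thm. 2.1] -/
theorem exists_killingOn_source_eqOn (hN : PseudoRiemannianMetric.Nomizu1960_killing_extension)
    {E : Type} [NormedAddCommGroup E] [NormedSpace ℝ E] [FiniteDimensional ℝ E] [CompleteSpace E]
    {X : Type*} [TopologicalSpace X] [ChartedSpace E X] [IsManifold 𝓘(ℝ, E) ∞ X]
    {ψ : OpenPartialHomeomorph X E}
    (g : PseudoRiemannianMetric 𝓘(ℝ, E) ∞ E (TangentSpace 𝓘(ℝ, E) : X → Type _)) [g.HasLeviCivita]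
    (hψ : ψ ∈ IsManifold.maximalAtlas 𝓘(ℝ, E) ∞ X)
    (hA : ∀ a b : E, AnalyticOnNhd ℝ
      (fun p : E ↦ g.val (ψ.symm p) (mfderiv 𝓘(ℝ, E) 𝓘(ℝ, E) ψ.symm p a)
        (mfderiv 𝓘(ℝ, E) 𝓘(ℝ, E) ψ.symm p b)) ψ.target)
    (hsc : IsSimplyConnected ψ.target) {D : Set X} (hD : IsOpen D)
    (hDc : IsConnected (ψ '' (ψ.source ∩ D)))
    {L : Π x : X, TangentSpace 𝓘(ℝ, E) x} (hL : g.IsKillingFieldOn L D) :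
    ∃ L' : Π x : X, TangentSpace 𝓘(ℝ, E) x,
      g.IsKillingFieldOn L' ψ.source ∧ ∀ x ∈ ψ.source ∩ D, L' x = L x := by
  haveI := (metric g hψ).hasLeviCivita
  -- the analytic metric on the chart target, with the same connection
  obtain ⟨gω, hgω⟩ := exists_analyticMetric_target g hψ hA
  haveI := gω.hasLeviCivita
  have hLC : gω.leviCivita = (metric g hψ).leviCivita :=
    PseudoRiemannianMetric.leviCivita_congr_of_val_eq hgω
  haveI : SimplyConnectedSpace (target ψ) := hsc
  -- the transported local Killing field
  set O : Set (target ψ) := inv ψ ⁻¹' D with hO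
  have hOo : IsOpen O := isOpen_inv_preimage hD
  have hOc : IsConnected O := isConnected_inv_preimage hDc
  have hYK : (metric g hψ).IsKillingFieldOn (mpullback 𝓘(ℝ, E) 𝓘(ℝ, E) (inv ψ) L) O :=
    isKillingFieldOn_mpullback_inv g hψ hD hL
  have hYKω : ∀ p ∈ O, ∀ v w : TangentSpace 𝓘(ℝ, E) p,
      gω.val p (gω.leviCivita (mpullback 𝓘(ℝ, E) 𝓘(ℝ, E) (inv ψ) L) p v) w +
        gω.val p v (gω.leviCivita (mpullback 𝓘(ℝ, E) 𝓘(ℝ, E) (inv ψ) L) p w) = 0 := by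
    intro p hp v w
    rw [hLC, hgω p]
    exact hYK.2 p hp v w
  -- Nomizu on the chart target
  obtain ⟨Yhat, hYs, hYk, hYeq⟩ := hN 𝓘(ℝ, E) (target ψ) gω O _ hOo hOc hYK.1 hYKω
  -- up again
  obtain ⟨L', hL's, hL'Y⟩ := exists_contMDiffOn_source_mpullback_inv_eq hψ Yhat hYs
  have hpb : mpullback 𝓘(ℝ, E) 𝓘(ℝ, E) (inv ψ) L' = Yhat := funext hL'Y
  have hK : ∀ (p : target ψ) (Y₀ Z₀ : TangentSpace 𝓘(ℝ, E) p),
      (metric g hψ).val p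
          ((metric g hψ).leviCivita (mpullback 𝓘(ℝ, E) 𝓘(ℝ, E) (inv ψ) L') p Y₀) Z₀ +
        (metric g hψ).val p Y₀
          ((metric g hψ).leviCivita (mpullback 𝓘(ℝ, E) 𝓘(ℝ, E) (inv ψ) L') p Z₀) = 0 := by
    intro p Y₀ Z₀
    have h := hYk p Y₀ Z₀
    rw [hLC, hgω p] at h
    rw [hpb]
    exact h
  refine ⟨L', ⟨hL's, killingOn_source_of_mpullback_inv g hψ hL's hK⟩, fun x hx ↦ ?_⟩
  obtain ⟨p, rfl⟩ := exists_inv_eq hx.1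
  refine apply_inv_eq_of_mpullback_eq hψ ?_
  rw [hL'Y p]
  exact hYeq p hx.2

/-- **Local Nomizu with commutation.** Under the hypotheses of `exists_killingOn_source_eqOn`, if
moreover `T` is a global Killing field of `g` with `[T, L] = 0` on `D`, the extension `L'` may be
taken with `[T, L'] = 0` on `ψ.source` (indeed every extension has this property,
`mlieBracket_eqOn_source_zero`: `[T, L'] = [T, L] = 0` on the open `ψ.source ∩ D` by locality of
the bracket). [cite: Chrusciel1997, Thm. 2.1] -/
theorem exists_killingOn_source_mlieBracket_zero_eqOn
    (hN : PseudoRiemannianMetric.Nomizu1960_killing_extension)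
    {E : Type} [NormedAddCommGroup E] [NormedSpace ℝ E] [FiniteDimensional ℝ E] [CompleteSpace E]
    {X : Type*} [TopologicalSpace X] [ChartedSpace E X] [IsManifold 𝓘(ℝ, E) ∞ X]
    {ψ : OpenPartialHomeomorph X E}
    (g : PseudoRiemannianMetric 𝓘(ℝ, E) ∞ E (TangentSpace 𝓘(ℝ, E) : X → Type _)) [g.HasLeviCivita]
    (hψ : ψ ∈ IsManifold.maximalAtlas 𝓘(ℝ, E) ∞ X)
    (hA : ∀ a b : E, AnalyticOnNhd ℝ
      (fun p : E ↦ g.val (ψ.symm p) (mfderiv 𝓘(ℝ, E) 𝓘(ℝ, E) ψ.symm p a)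
        (mfderiv 𝓘(ℝ, E) 𝓘(ℝ, E) ψ.symm p b)) ψ.target)
    (hsc : IsSimplyConnected ψ.target) {D : Set X} (hD : IsOpen D)
    (hDc : IsConnected (ψ '' (ψ.source ∩ D)))
    {L : Π x : X, TangentSpace 𝓘(ℝ, E) x} (hL : g.IsKillingFieldOn L D)
    {T : Π x : X, TangentSpace 𝓘(ℝ, E) x} (hT : g.IsKillingField T)
    (hTL : ∀ x ∈ D, mlieBracket 𝓘(ℝ, E) T L x = 0) :
    ∃ L' : Π x : X, TangentSpace 𝓘(ℝ, E) x,
      g.IsKillingFieldOn L' ψ.source ∧ (∀ x ∈ ψ.source, mlieBracket 𝓘(ℝ, E) T L' x = 0) ∧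
        ∀ x ∈ ψ.source ∩ D, L' x = L x := by
  obtain ⟨L', hL'K, hL'eq⟩ := exists_killingOn_source_eqOn hN g hψ hA hsc hD hDc hL
  refine ⟨L', hL'K, ?_, hL'eq⟩
  have hne : (ψ.source ∩ D).Nonempty := by
    obtain ⟨_, x, hx, -⟩ := hDc.nonempty
    exact ⟨x, hx⟩
  have hpc : IsPreconnected ψ.target := hsc.isPathConnected.isConnected.isPreconnected
  refine mlieBracket_eqOn_source_zero g hψ hpc hT hL'K hD hne fun x hx ↦ ?_
  -- `[T, L'] = [T, L] = 0` on the open `ψ.source ∩ D`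
  have hev : L' =ᶠ[𝓝 x] L :=
    Filter.eventually_of_mem ((ψ.open_source.inter hD).mem_nhds hx) fun y hy ↦ hL'eq y hy
  rw [(Filter.EventuallyEq.rfl (f := T)).mlieBracket_vectorField_eq hev]
  exact hTL x hx.2

end MaxAtlasChart

end Literature.Geometry.Lorentzian

end
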